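import Summits.SmoothPoincare4.SmoothPoincare4.Theses.EntropyRung
import Summits.SmoothPoincare4.SmoothPoincare4.Theorems.EntropyRungSubcylindricalExistenceScalarPositiveUpgradeGroundState
import Summits.SmoothPoincare4.SmoothPoincare4.Theorems.EntropyRungSubcylindricalExistenceScalarPositiveUpgradeFactor
import Summits.SmoothPoincare4.SmoothPoincare4.Theorems.EntropyRungSubcylindricalExistenceConformalRealisation
import Summits.SmoothPoincare4.SmoothPoincare4.Theorems.EntropyRungSubcylindricalExistenceGluingAllScales
import Literature.Geometry.Riemannian.BakryEmeryHeatFlow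
import HarnessLib

/-!
# Stub U `stub_scalarPositiveUpgrade`: positivity upgrade `R ≥ 0, R ≢ 0 ⇒ R > 0` with an explicit
# entropy loss (line `fat-conical-core-avr-logsobolev`, crux `EntropyRung.SubcylindricalExistence`,
# stmt-SmoothPoincare4-10871)

On a closed CONNECTED smooth `4`-manifold of the summit binder, a Riemannian `G` (Levi-Civita) with
`R_G ≥ 0` everywhere, `R_G > 0` somewhere, whose Perelman clause
`∀ τ > 0 ∀ f, ∫ (4πτ)⁻² e^{-f} dV = 1 → L ≤ ∫ (τ(R + |∇f|²) + f − 4)(4πτ)⁻² e^{-f} dV` holds at level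
`L`, admits for every `ε > 0` a conformal metric `G' = ψ² G` with `R_{G'} > 0` everywhere and the
clause at level `L − ε`.

Proof (a small conformal nudge by the ground state of the conformal Laplacian):
1. `helper_stub_scalarPositiveUpgrade_groundState`: a smooth `φ > 0` and `λ > 0` with
   `R φ − 6 Δ φ = λ φ`; by compactness `φ ≤ Φ`, `φ ≥ φ_min > 0`, `|∇φ|² ≤ C`.
2. `helper_stub_scalarPositiveUpgrade_factor` with `ε' = min(1/2, ε/32)` and
   `t = min(min(1/(Φ+1), ε/(128(Φ+1))), ε ε' λ φ_min/(4096 (C+1)²))`: the factor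
   `ψ = (1 + tφ)/(1 + tΦ)²` is smooth, positive, `L_G ψ > 0`, and the `ψ`-weighted `w²`-clause holds
   at every scale at level `L + 2 log(1−ε') − 16 tΦ − 512 t (C+1)²/(ε' λ φ_min) ≥ L − ε/2`.
3. `gluingExpForm` passes to the `e^{-f}`-form (`w = e^{-f/2}`), and `stub_conformalRealisation`
   realises `G' = ψ² G` (Levi-Civita, Riemannian, `R' = ψ⁻³ L_G ψ > 0`) with the genuine clause at
   level `(L − ε) + ε/2`, hence at level `L − ε`.
Everything is proved; no definition, no named fact.

References: G. Perelman, arXiv:math/0211159, §3.1 [Perelman2002Entropy]; T. Aubin, *Nonlinear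
Analysis on Manifolds* (1982), Ch. 6, §6.3 and Remark 6.21 [Aubin1982].
-/

noncomputable section

-- the registered namespace `Summit.SmoothPoincare4.SmoothPoincare4.Theorems` repeats a component
set_option linter.dupNamespace false

open scoped Manifold ContDiff Topology ENNReal NNReal
open Set Filter MeasureTheory
open Literature.Geometry.Lorentzian Literature.Geometry.Riemannian

namespace Summit.SmoothPoincare4.SmoothPoincare4.Theorems

namespace ScalarPositiveUpgradeAux

/-- `2 log(1 − ε') ≥ −4 ε'` for `0 < ε' ≤ 1/2` (`log y ≥ 1 − 1/y`). -/
theorem two_mul_log_one_sub_ge {ε' : ℝ} (h0 : 0 < ε') (h1 : ε' ≤ 1 / 2) :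
    -(4 * ε') ≤ 2 * Real.log (1 - ε') := by
  have hpos : 0 < 1 - ε' := by linarith
  have h := Real.one_sub_inv_le_log_of_pos hpos
  have hinv : (1 - ε')⁻¹ ≤ 1 + 2 * ε' := by
    rw [inv_le_iff_one_le_mul₀ hpos]
    nlinarith [mul_nonneg h0.le (by linarith : (0 : ℝ) ≤ 1 - 2 * ε')]
  linarith

/-- The choice of `t`: with `t ≤ ε/(128(Φ+1))` and `t ≤ ε ε' λ φ_min/(4096 (C+1)²)` the two
`t`-losses are each at most `ε/8`. -/
theorem losses_le {ε ε' t Φ C lam φmin : ℝ} (hε' : 0 < ε') (ht : 0 < t) (hΦ : 0 ≤ Φ) (hC : 0 ≤ C)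
    (hlam : 0 < lam) (hφmin : 0 < φmin)
    (h1 : t ≤ ε / (128 * (Φ + 1))) (h2 : t ≤ ε * ε' * lam * φmin / (4096 * (C + 1) ^ 2)) :
    16 * t * Φ ≤ ε / 8 ∧ 512 * t * (C + 1) ^ 2 / (ε' * lam * φmin) ≤ ε / 8 := by
  constructor
  · have h1' : t * (128 * (Φ + 1)) ≤ ε := (le_div_iff₀ (by positivity)).1 h1
    nlinarith [mul_nonneg ht.le hΦ]
  · rw [div_le_iff₀ (by positivity)]
    have h2' : t * (4096 * (C + 1) ^ 2) ≤ ε * ε' * lam * φmin := (le_div_iff₀ (by positivity)).1 h2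
    nlinarith

end ScalarPositiveUpgradeAux

open ScalarPositiveUpgradeAux in
/-- **Stub U · `stub_scalarPositiveUpgrade`** (line `fat-conical-core-avr-logsobolev`): on a closed
connected smooth `4`-manifold, a Riemannian `G` with `R_G ≥ 0`, `R_G ≢ 0` and Perelman's clause at
level `L` admits, for every `ε > 0`, a metric `G'` (Levi-Civita, Riemannian) with `R_{G'} > 0`
everywhere and the clause at level `L − ε`: the conformal nudge `G' = ψ² G`,
`ψ = (1 + tφ)/(1 + t max φ)²` by the positive ground state `φ` of the conformal Laplacian, `t` small.
[cite: Perelman2002Entropy, §3.1] [cite: Aubin1982, Ch. 6, §6.3] -/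
theorem stub_scalarPositiveUpgrade :
    ∀ (M : Type) [TopologicalSpace M] [T2Space M] [SecondCountableTopology M]
    [ChartedSpace (EuclideanSpace ℝ (Fin 4)) M] [IsManifold (𝓡 4) ∞ M] [CompactSpace M]
    [ConnectedSpace M] [T3Space M] [MeasurableSpace M] [BorelSpace M]
    (G : PseudoRiemannianMetric (𝓡 4) ∞ (EuclideanSpace ℝ (Fin 4)) (TangentSpace (𝓡 4) : M → Type _))
    [G.HasLeviCivita] (hG : G.IsRiemannian) (L : ℝ),
    (∀ x : M, 0 ≤ G.scalarCurvature x) → (∃ x : M, 0 < G.scalarCurvature x) →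
    (∀ τ : ℝ, 0 < τ → ∀ f : M → ℝ, ContMDiff (𝓡 4) 𝓘(ℝ, ℝ) ∞ f →
      ∫ x, (4 * Real.pi * τ) ^ (-(4 : ℝ) / 2) * Real.exp (-f x)
          ∂(riemannianMeasure (G.toContMDiffRiemannianMetric hG)) = 1 →
        L ≤ ∫ x, (τ * (G.scalarCurvature x + G.gradSq f x) + f x - 4) *
          ((4 * Real.pi * τ) ^ (-(4 : ℝ) / 2) * Real.exp (-f x))
          ∂(riemannianMeasure (G.toContMDiffRiemannianMetric hG))) →
    ∀ ε : ℝ, 0 < ε →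
      ∃ G' : PseudoRiemannianMetric (𝓡 4) ∞ (EuclideanSpace ℝ (Fin 4)) (TangentSpace (𝓡 4) : M → Type _),
      ∃ _ : G'.HasLeviCivita, ∃ hG' : G'.IsRiemannian,
        (∀ x : M, 0 < G'.scalarCurvature x) ∧
        ∀ τ : ℝ, 0 < τ → ∀ f : M → ℝ, ContMDiff (𝓡 4) 𝓘(ℝ, ℝ) ∞ f →
          ∫ x, (4 * Real.pi * τ) ^ (-(4 : ℝ) / 2) * Real.exp (-f x)
              ∂(riemannianMeasure (G'.toContMDiffRiemannianMetric hG')) = 1 →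
            L - ε ≤ ∫ x, (τ * (G'.scalarCurvature x + G'.gradSq f x) + f x - 4) *
              ((4 * Real.pi * τ) ^ (-(4 : ℝ) / 2) * Real.exp (-f x))
              ∂(riemannianMeasure (G'.toContMDiffRiemannianMetric hG')) := by
  intro M _ _ _ _ _ _ _ _ _ _ G _ hG L hR0 hRpos hclause ε hε
  -- Step 1: the positive ground state and its bounds
  obtain ⟨φ, lam, hφ, hφpos, hlam, heq⟩ := helper_stub_scalarPositiveUpgrade_groundState M G hG hR0 hRpos
  obtain ⟨x₀, -⟩ := hRpos
  haveI : Nonempty M := ⟨x₀⟩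
  have hφc : Continuous φ := hφ.continuous
  obtain ⟨xM, -, hxM⟩ := isCompact_univ.exists_isMaxOn univ_nonempty hφc.continuousOn
  obtain ⟨xm, -, hxm⟩ := isCompact_univ.exists_isMinOn univ_nonempty hφc.continuousOn
  have hGc : Continuous (G.gradSq φ) := (contMDiff_gradSq G hφ).continuous
  obtain ⟨xC, -, hxC⟩ := isCompact_univ.exists_isMaxOn univ_nonempty hGc.continuousOn
  set Φ : ℝ := φ xM with hΦ
  set φmin : ℝ := φ xm with hφmin
  set C : ℝ := G.gradSq φ xC with hC
  have hΦle : ∀ x, φ x ≤ Φ := fun x ↦ isMaxOn_iff.1 hxM x (mem_univ x)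
  have hφmin' : ∀ x, φmin ≤ φ x := fun x ↦ isMinOn_iff.1 hxm x (mem_univ x)
  have hCle : ∀ x, G.gradSq φ x ≤ C := fun x ↦ isMaxOn_iff.1 hxC x (mem_univ x)
  have hΦ0 : 0 < Φ := hφpos xM
  have hφmin0 : 0 < φmin := hφpos xm
  have hC0 : 0 ≤ C := G.gradSq_nonneg hG φ xC
  -- Step 2: the constants `ε'` and `t`
  set ε' : ℝ := min (1 / 2) (ε / 32) with hε'
  have hε'0 : 0 < ε' := lt_min (by norm_num) (by positivity)
  have hε'1 : ε' < 1 := (min_le_left _ _).trans_lt (by norm_num)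
  have hε'2 : ε' ≤ 1 / 2 := min_le_left _ _
  have hε'3 : ε' ≤ ε / 32 := min_le_right _ _
  set t : ℝ := min (min (1 / (Φ + 1)) (ε / (128 * (Φ + 1)))) (ε * ε' * lam * φmin / (4096 * (C + 1) ^ 2))
    with ht
  have ht0 : 0 < t := lt_min (lt_min (by positivity) (by positivity)) (by positivity)
  have ht1 : t ≤ 1 / (Φ + 1) := (min_le_left _ _).trans (min_le_left _ _)
  have ht2 : t ≤ ε / (128 * (Φ + 1)) := (min_le_left _ _).trans (min_le_right _ _)
  have ht3 : t ≤ ε * ε' * lam * φmin / (4096 * (C + 1) ^ 2) := min_le_right _ _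
  have htΦ : t * Φ ≤ 1 := by
    have h := (le_div_iff₀ (by positivity : (0 : ℝ) < Φ + 1)).1 ht1
    nlinarith
  -- Step 3: the factor and its clause at every scale
  obtain ⟨ψ, hψ, hψpos, hLψ, hall⟩ := helper_stub_scalarPositiveUpgrade_factor M G hG φ lam Φ φmin C L ε' t
    hφ hφpos hlam heq hR0 hΦ0.le hΦle hφmin0 hφmin' hC0 hCle hclause hε'0 hε'1 ht0 htΦ
  have hlog := two_mul_log_one_sub_ge hε'0 hε'2
  obtain ⟨hl1, hl2⟩ := losses_le hε'0 ht0 hΦ0.le hC0 hlam hφmin0 ht2 ht3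
  have hlevel : L - ε + ε / 2 ≤
      L + 2 * Real.log (1 - ε') - 16 * t * Φ - 512 * t * (C + 1) ^ 2 / (ε' * lam * φmin) := by
    linarith
  -- Step 4: `e^{-f}`-form and realisation of `ψ² G`
  have hW : ∃ δ : ℝ, 0 < δ ∧ ∀ τ : ℝ, 0 < τ → ∀ f : M → ℝ, ContMDiff (𝓡 4) 𝓘(ℝ, ℝ) ∞ f →
      ∫ x, (4 * Real.pi * τ) ^ (-(4 : ℝ) / 2) * Real.exp (-f x) * ψ x ^ 4
          ∂(riemannianMeasure (G.toContMDiffRiemannianMetric hG)) = 1 →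
        L - ε + δ ≤
          ∫ x, (τ * ((ψ x ^ 3)⁻¹ * (G.scalarCurvature x * ψ x - 6 * G.dalembertian ψ x) +
                (ψ x ^ 2)⁻¹ * G.gradSq f x) + f x - 4) *
              ((4 * Real.pi * τ) ^ (-(4 : ℝ) / 2) * Real.exp (-f x)) * ψ x ^ 4
            ∂(riemannianMeasure (G.toContMDiffRiemannianMetric hG)) :=
    ⟨ε / 2, by positivity, fun τ hτ f hf hn ↦ gluingExpForm M G hG ψ hψpos (L - ε + ε / 2) τ hτ
      (fun w hw hnw ↦ hlevel.trans (hall τ hτ w hw hnw)) f hf hn⟩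
  obtain ⟨G', hLC', hG', -, hR', δ', hδ', hclause'⟩ :=
    stub_conformalRealisation M G hG ψ hψ hψpos hLψ (L - ε) hW
  exact ⟨G', hLC', hG', hR', fun τ hτ f hf hn ↦ by linarith [hclause' τ hτ f hf hn]⟩

end Summit.SmoothPoincare4.SmoothPoincare4.Theorems

end
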